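import Literature.NumberTheory.EllipticCurves.TateCurve.TateFormalTheta
import Literature.NumberTheory.EllipticCurves.TateCurve.ComplexTateTheta
import Literature.NumberTheory.EllipticCurves.TateCurve.TateFormalAdditionIdentity
import Literature.NumberTheory.EllipticCurves.TateCurve.TatePointHom
import HarnessLib

/-!
# Silverman ATAEC Prop. V.3.2 (b)(i) in every complete field:
# `(X(u₁) − X(u₂)) θ(u₁)² θ(u₂)² = −u₂ θ(u₁u₂) θ(u₁u₂⁻¹)` for `u₁, u₂ ∈ K^* ∖ q^ℤ`

Topic `Literature/NumberTheory/EllipticCurves/TateCurve`, namespace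
`Literature.NumberTheory.EllipticCurves.TateCurve` (cell `bsd-eis`, seat `bsd-eis-k5-c4` g3; step T1
of the discharge of `SteinWuthrich2013.exists_isSplitMultCanonical`: this is the hypothesis `hV32`
of `SteinWuthrich2013.exists_isSplitMultCanonical_of_thetaRelation`). Theorems only.

Silverman, *Advanced Topics*, Prop. V.3.2 (b) (PDF pp. 399–400), proved as he proves Thm. V.3.1
(c): the relation, cleared of denominators, is the formal `q`-series `thetaRel`
(`TateFormalThetaDefs`); its evaluation at complex `(u₁,u₂,q)` in the configuration
`|u₁| = 1/2, |u₂| = 1/3, 0 < |q| ≤ 1/7` is `(1−u₁)²(1−u₂)²P(1)⁸ × [complex theta relation] = 0`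
(`ev_thetaRel`, `complexTate_thetaRelation`), so `thetaRel = 0` by the identity principle
(`eq_zero_of_ev₂_eq_zero`); evaluating in a complete nontrivially normed field `K` gives the
relation for `u₁, u₂ ≠ 1` in the annulus `|q| < |u| < |q|⁻¹`, and the functional equations
`X(qu) = X(u)`, `θ(qu) = −u⁻¹θ(u)` (under which both sides scale by the same unit) move arbitrary
`u₁, u₂ ∈ K^* ∖ q^ℤ` into the annulus.

* `thetaRel_eq_zero` — **the formal theta relation vanishes in `ℤ[u₂^{±1}][u₁^{±1}]⟦q⟧`**;
* `tate_thetaRelation_annulus` — the relation for `u₁, u₂ ≠ 1` in the annulus;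
* `tate_thetaRelation_mul_left_iff`, `tate_thetaRelation_mul_right_iff` (and `zpow` versions) —
  invariance under `uᵢ ↦ q uᵢ`;
* **`tate_thetaRelation`** — for `0 < ‖q‖ < 1` and `u₁, u₂ ∈ K^* ∖ q^ℤ`:
  `(tateX q u₁ − tateX q u₂)·tateTheta q u₁²·tateTheta q u₂² = −(u₂·tateTheta q (u₁u₂)·tateTheta q (u₁u₂⁻¹))`.

## References
* [SilvermanATAEC1994] J. H. Silverman, *Advanced Topics in the Arithmetic of Elliptic Curves*,
  GTM 151, Springer 1994, Prop. V.3.2 (PDF pp. 399–400); proof of Thm. V.3.1 (c) (PDF pp. 397–398).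
-/

noncomputable section

open Complex LaurentPolynomial

namespace Literature.NumberTheory.EllipticCurves.TateCurve

open SteinWuthrich2013

/-! ### Vanishing of the formal relation -/

/-- The set `{u ∈ ℂˣ : ‖u‖ = r}` is infinite for `0 < r` (`n ↦ r(n+i)/(n−i)` is injective into it).
[folklore] -/
private theorem infinite_norm_eq'' {r : ℝ} (hr : 0 < r) : {u : ℂˣ | ‖(u : ℂ)‖ = r}.Infinite := by
  have hden : ∀ n : ℕ, ((n : ℂ) - I) ≠ 0 := fun n h ↦ by
    have := congrArg Complex.im h; simp at this
  have hnum : ∀ n : ℕ, ((n : ℂ) + I) ≠ 0 := fun n h ↦ by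
    have := congrArg Complex.im h; simp at this
  have hne : ∀ n : ℕ, (r : ℂ) * (((n : ℂ) + I) / ((n : ℂ) - I)) ≠ 0 := fun n ↦
    mul_ne_zero (by exact_mod_cast hr.ne') (div_ne_zero (hnum n) (hden n))
  have hinj : Function.Injective fun n : ℕ ↦ Units.mk0 _ (hne n) := by
    intro m n hmn
    have h := congrArg (fun x : ℂˣ ↦ (x : ℂ)) hmn
    simp only [Units.val_mk0] at h
    have hr' : (r : ℂ) ≠ 0 := by exact_mod_cast hr.ne'
    have h' := mul_left_cancel₀ hr' h
    rw [div_eq_div_iff (hden m) (hden n)] at h'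
    have h'' : (2 * I) * ((m : ℂ) - n) = 0 := by linear_combination -h'
    have h3 : ((m : ℂ) - n) = 0 := by
      rcases mul_eq_zero.mp h'' with h | h
      · exfalso; apply Complex.I_ne_zero
        have : (2 : ℂ) ≠ 0 := by norm_num
        exact (mul_eq_zero.mp h).resolve_left this
      · exact h
    exact_mod_cast sub_eq_zero.mp h3
  refine Set.infinite_of_injective_forall_mem hinj fun n ↦ ?_
  show ‖((Units.mk0 _ (hne n) : ℂˣ) : ℂ)‖ = r
  rw [Units.val_mk0, norm_mul, norm_div, Complex.norm_real, Real.norm_of_nonneg hr.le]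
  have : ‖(n : ℂ) - I‖ = ‖(n : ℂ) + I‖ := by
    have hc : (starRingEnd ℂ) ((n : ℂ) + I) = (n : ℂ) - I := by
      rw [map_add, Complex.conj_natCast, Complex.conj_I, sub_eq_add_neg]
    rw [← hc, Complex.norm_conj]
  rw [this, div_self (norm_ne_zero_iff.mpr (hnum n)), mul_one]

/-- In the configuration `|u₁| = 1/2`, `|u₂| = 1/3`, `0 < |q| ≤ 1/7` the evaluation of `thetaRel`
vanishes: it is `(1−u₁)²(1−u₂)²P(1)⁸` times the complex theta relation
(`complexTate_thetaRelation` at the `τ, z, w` of `exists_complexConfig`).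
[cite: SilvermanATAEC1994, Prop. V.3.2 (b) (PDF pp. 399–400)] -/
private theorem ev_thetaRel_eq_zero (u₁ u₂ : ℂˣ) (q : ℂ) (h₁ : ‖(u₁ : ℂ)‖ = 1 / 2)
    (h₂ : ‖(u₂ : ℂ)‖ = 1 / 3) (hq0 : 0 < ‖q‖) (hq : ‖q‖ ≤ 1 / 7) :
    PowerSeriesEval.ev (evCoeff₂ u₁ u₂) q thetaRel = 0 := by
  have hq1 : ‖q‖ < 1 := by linarith
  have hq7 : ‖q‖⁻¹ ≥ 7 := by
    rw [ge_iff_le, le_inv_comm₀ (by norm_num) hq0]; linarith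
  have a₁ : ‖q‖ < ‖(u₁ : ℂ)‖ := by rw [h₁]; linarith
  have a₁' : ‖(u₁ : ℂ)‖ < ‖q‖⁻¹ := by rw [h₁]; linarith
  have a₂ : ‖q‖ < ‖(u₂ : ℂ)‖ := by rw [h₂]; linarith
  have a₂' : ‖(u₂ : ℂ)‖ < ‖q‖⁻¹ := by rw [h₂]; linarith
  have n₁ : (u₁ : ℂ) ≠ 1 := by intro h; rw [h, norm_one] at h₁; norm_num at h₁
  have n₂ : (u₂ : ℂ) ≠ 1 := by intro h; rw [h, norm_one] at h₂; norm_num at h₂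
  have hx₁ := sq_mul_tateX_eq_ev u₁ a₁ a₁' n₁
  have hx₂ := sq_mul_tateX_eq_ev u₂ a₂ a₂' n₂
  obtain ⟨τ, z, w, hz, hw, hzw, hqe, hu₁e, hu₂e, -⟩ := exists_complexConfig h₁ h₂ hq0 hq
  have hC := complexTate_thetaRelation τ hz (by linarith) hw (by linarith)
  simp only [hqe, hu₁e, hu₂e] at hC
  rw [ev_thetaRel u₁ u₂ hq1 a₁ a₁' a₂ a₂' hx₁ hx₂,
    show (tateX q (u₁ : ℂ) - tateX q (u₂ : ℂ)) * tateTheta q (u₁ : ℂ) ^ 2 * tateTheta q (u₂ : ℂ) ^ 2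
        + (u₂ : ℂ) * tateTheta q ((u₁ : ℂ) * u₂) * tateTheta q ((u₁ : ℂ) * (u₂ : ℂ)⁻¹) = 0 by
      linear_combination hC, mul_zero]

/-- **`thetaRel = 0` in `ℤ[u₂^{±1}][u₁^{±1}]⟦q⟧`**: Silverman's theta relation (b)(i) is a formal
identity (identity principle on `{|u₁| = 1/2} × {|u₂| = 1/3} × {0 < |q| ≤ 1/7}`).
[cite: SilvermanATAEC1994, Prop. V.3.2 (b) (PDF pp. 399–400)] -/
theorem thetaRel_eq_zero : thetaRel = 0 := by
  refine eq_zero_of_ev₂_eq_zero thetaRel (infinite_norm_eq'' (by norm_num : (0 : ℝ) < 1 / 2))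
    (infinite_norm_eq'' (by norm_num : (0 : ℝ) < 1 / 3)) (fun _ _ ↦ 1 / 7) (fun _ _ _ _ ↦ by norm_num)
    (fun u₁ hu₁ u₂ hu₂ ↦ ?_) (fun u₁ hu₁ u₂ hu₂ q hq0 hq ↦ ev_thetaRel_eq_zero u₁ u₂ q hu₁ hu₂ hq0 hq)
  have h₁ : ‖(u₁ : ℂ)‖ = 1 / 2 := hu₁
  have h₂ : ‖(u₂ : ℂ)‖ = 1 / 3 := hu₂
  have hq : ‖(((1 / 7 : ℝ)) : ℂ)‖ = 1 / 7 := by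
    rw [Complex.norm_real, Real.norm_of_nonneg (by norm_num)]
  have hq1 : ‖(((1 / 7 : ℝ)) : ℂ)‖ < 1 := by rw [hq]; norm_num
  have a₁ : ‖(((1 / 7 : ℝ)) : ℂ)‖ < ‖(u₁ : ℂ)‖ := by rw [hq, h₁]; norm_num
  have a₁' : ‖(u₁ : ℂ)‖ < ‖(((1 / 7 : ℝ)) : ℂ)‖⁻¹ := by rw [hq, h₁]; norm_num
  have a₂ : ‖(((1 / 7 : ℝ)) : ℂ)‖ < ‖(u₂ : ℂ)‖ := by rw [hq, h₂]; norm_num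
  have a₂' : ‖(u₂ : ℂ)‖ < ‖(((1 / 7 : ℝ)) : ℂ)‖⁻¹ := by rw [hq, h₂]; norm_num
  exact conv_thetaRel u₁ u₂ hq1 a₁ a₁' a₂ a₂'

/-! ### The relation in complete fields -/

section General

variable {K : Type*} [NontriviallyNormedField K] [CompleteSpace K] {q : K}

/-- **Prop. V.3.2 (b)(i) on the annulus**: for `‖q‖ < 1`, `u₁, u₂ ≠ 1` in `|q| < |u| < |q|⁻¹`
(complete nontrivially normed field),
`(X(u₁) − X(u₂)) θ(u₁)² θ(u₂)² = −u₂ θ(u₁u₂) θ(u₁u₂⁻¹)` — evaluate `thetaRel = 0`.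
[cite: SilvermanATAEC1994, Prop. V.3.2 (b) (PDF pp. 399–400)] -/
theorem tate_thetaRelation_annulus (hq : ‖q‖ < 1) (u₁ u₂ : Kˣ) (h₁ : ‖q‖ < ‖(u₁ : K)‖)
    (h₁' : ‖(u₁ : K)‖ < ‖q‖⁻¹) (h₂ : ‖q‖ < ‖(u₂ : K)‖) (h₂' : ‖(u₂ : K)‖ < ‖q‖⁻¹)
    (n₁ : (u₁ : K) ≠ 1) (n₂ : (u₂ : K) ≠ 1) :
    (tateX q (u₁ : K) - tateX q (u₂ : K)) * tateTheta q (u₁ : K) ^ 2 * tateTheta q (u₂ : K) ^ 2 =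
      -((u₂ : K) * tateTheta q ((u₁ : K) * u₂) * tateTheta q ((u₁ : K) * (u₂ : K)⁻¹)) := by
  have h := ev_thetaRel u₁ u₂ hq h₁ h₁' h₂ h₂' (sq_mul_tateX_eq_ev u₁ h₁ h₁' n₁)
    (sq_mul_tateX_eq_ev u₂ h₂ h₂' n₂)
  rw [thetaRel_eq_zero, show (0 : LaurentQSeries₂) = PowerSeries.C 0 from (map_zero _).symm,
    PowerSeriesEval.ev_C, map_zero] at h
  have hpre : (1 - (u₁ : K)) ^ 2 * (1 - (u₂ : K)) ^ 2 * tateP q (1 : K) ^ 8 ≠ 0 :=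
    mul_ne_zero (mul_ne_zero (pow_ne_zero 2 (sub_ne_zero.mpr (Ne.symm n₁)))
      (pow_ne_zero 2 (sub_ne_zero.mpr (Ne.symm n₂)))) (pow_ne_zero 8 (tateP_one_ne_zero hq))
  have h0 := (mul_eq_zero.mp h.symm).resolve_left hpre
  linear_combination h0

/-- Invariance of (b)(i) under `u₁ ↦ q u₁`: both sides scale by `u₁⁻²` (`X(qu) = X(u)`,
`θ(qu) = −u⁻¹θ(u)`). [cite: SilvermanATAEC1994, Prop. V.3.2 (a),(b) (PDF pp. 399–400)] -/
theorem tate_thetaRelation_mul_left_iff (hq : ‖q‖ < 1) (hq0 : q ≠ 0) {v u₂ : K} (hv : v ≠ 0)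
    (hu₂ : u₂ ≠ 0) :
    (tateX q (q * v) - tateX q u₂) * tateTheta q (q * v) ^ 2 * tateTheta q u₂ ^ 2 =
        -(u₂ * tateTheta q (q * v * u₂) * tateTheta q (q * v * u₂⁻¹)) ↔
      (tateX q v - tateX q u₂) * tateTheta q v ^ 2 * tateTheta q u₂ ^ 2 =
        -(u₂ * tateTheta q (v * u₂) * tateTheta q (v * u₂⁻¹)) := by
  have e1 : tateTheta q (q * v) = -v⁻¹ * tateTheta q v := tateTheta_mul_left hq hq0 hv
  have e2 : tateTheta q (q * v * u₂) = -(v * u₂)⁻¹ * tateTheta q (v * u₂) := by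
    rw [mul_assoc]; exact tateTheta_mul_left hq hq0 (mul_ne_zero hv hu₂)
  have e3 : tateTheta q (q * v * u₂⁻¹) = -(v * u₂⁻¹)⁻¹ * tateTheta q (v * u₂⁻¹) := by
    rw [mul_assoc]; exact tateTheta_mul_left hq hq0 (mul_ne_zero hv (inv_ne_zero hu₂))
  have hL : (tateX q (q * v) - tateX q u₂) * tateTheta q (q * v) ^ 2 * tateTheta q u₂ ^ 2 =
      v⁻¹ ^ 2 * ((tateX q v - tateX q u₂) * tateTheta q v ^ 2 * tateTheta q u₂ ^ 2) := by
    rw [tateX_mul_left hq0, e1]; ring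
  have hR : -(u₂ * tateTheta q (q * v * u₂) * tateTheta q (q * v * u₂⁻¹)) =
      v⁻¹ ^ 2 * -(u₂ * tateTheta q (v * u₂) * tateTheta q (v * u₂⁻¹)) := by
    rw [e2, e3, mul_inv, mul_inv, inv_inv]
    field_simp
  rw [hL, hR, mul_right_inj' (pow_ne_zero 2 (inv_ne_zero hv))]

/-- Invariance of (b)(i) under `u₂ ↦ q u₂`: both sides scale by `u₂⁻²` (`θ(qu) = −u⁻¹θ(u)`,
`θ(q⁻¹w) = −q⁻¹w θ(w)`). [cite: SilvermanATAEC1994, Prop. V.3.2 (a),(b) (PDF pp. 399–400)] -/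
theorem tate_thetaRelation_mul_right_iff (hq : ‖q‖ < 1) (hq0 : q ≠ 0) {u₁ v : K} (hu₁ : u₁ ≠ 0)
    (hv : v ≠ 0) :
    (tateX q u₁ - tateX q (q * v)) * tateTheta q u₁ ^ 2 * tateTheta q (q * v) ^ 2 =
        -(q * v * tateTheta q (u₁ * (q * v)) * tateTheta q (u₁ * (q * v)⁻¹)) ↔
      (tateX q u₁ - tateX q v) * tateTheta q u₁ ^ 2 * tateTheta q v ^ 2 =
        -(v * tateTheta q (u₁ * v) * tateTheta q (u₁ * v⁻¹)) := by
  have e1 : tateTheta q (q * v) = -v⁻¹ * tateTheta q v := tateTheta_mul_left hq hq0 hv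
  have e2 : tateTheta q (u₁ * (q * v)) = -(u₁ * v)⁻¹ * tateTheta q (u₁ * v) := by
    rw [mul_left_comm]; exact tateTheta_mul_left hq hq0 (mul_ne_zero hu₁ hv)
  have e3 : tateTheta q (u₁ * (q * v)⁻¹) = -(q⁻¹ * (u₁ * v⁻¹)) * tateTheta q (u₁ * v⁻¹) := by
    have h := tateTheta_eq_neg_mul hq hq0 (u := u₁ * (q * v)⁻¹)
      (mul_ne_zero hu₁ (inv_ne_zero (mul_ne_zero hq0 hv)))
    rw [h, show q * (u₁ * (q * v)⁻¹) = u₁ * v⁻¹ by field_simp,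
      show u₁ * (q * v)⁻¹ = q⁻¹ * (u₁ * v⁻¹) by rw [mul_inv]; ring]
  have hL : (tateX q u₁ - tateX q (q * v)) * tateTheta q u₁ ^ 2 * tateTheta q (q * v) ^ 2 =
      v⁻¹ ^ 2 * ((tateX q u₁ - tateX q v) * tateTheta q u₁ ^ 2 * tateTheta q v ^ 2) := by
    rw [tateX_mul_left hq0, e1]; ring
  have hR : -(q * v * tateTheta q (u₁ * (q * v)) * tateTheta q (u₁ * (q * v)⁻¹)) =
      v⁻¹ ^ 2 * -(v * tateTheta q (u₁ * v) * tateTheta q (u₁ * v⁻¹)) := by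
    rw [e2, e3, mul_inv]
    field_simp
  rw [hL, hR, mul_right_inj' (pow_ne_zero 2 (inv_ne_zero hv))]

/-- Invariance under `u₁ ↦ qᵏ u₁`, `k ∈ ℤ`. [cite: SilvermanATAEC1994, Prop. V.3.2 (a),(b) (PDF pp. 399–400)] -/
theorem tate_thetaRelation_zpow_mul_left_iff (hq : ‖q‖ < 1) (hq0 : q ≠ 0) {v u₂ : K} (hv : v ≠ 0)
    (hu₂ : u₂ ≠ 0) (k : ℤ) :
    (tateX q (q ^ k * v) - tateX q u₂) * tateTheta q (q ^ k * v) ^ 2 * tateTheta q u₂ ^ 2 =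
        -(u₂ * tateTheta q (q ^ k * v * u₂) * tateTheta q (q ^ k * v * u₂⁻¹)) ↔
      (tateX q v - tateX q u₂) * tateTheta q v ^ 2 * tateTheta q u₂ ^ 2 =
        -(u₂ * tateTheta q (v * u₂) * tateTheta q (v * u₂⁻¹)) := by
  induction k using Int.induction_on with
  | zero => rw [zpow_zero, one_mul]
  | succ k ih =>
    rw [zpow_add_one₀ hq0, mul_comm (q ^ (k : ℤ)) q, mul_assoc q,
      tate_thetaRelation_mul_left_iff hq hq0 (mul_ne_zero (zpow_ne_zero _ hq0) hv) hu₂, ih]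
  | pred k ih =>
    rw [← ih, show q ^ (-(k : ℤ)) * v = q * (q ^ (-(k : ℤ) - 1) * v) by
      rw [← mul_assoc, ← zpow_one_add₀ hq0]; ring_nf,
      tate_thetaRelation_mul_left_iff hq hq0 (mul_ne_zero (zpow_ne_zero _ hq0) hv) hu₂]

/-- Invariance under `u₂ ↦ qᵏ u₂`, `k ∈ ℤ`. [cite: SilvermanATAEC1994, Prop. V.3.2 (a),(b) (PDF pp. 399–400)] -/
theorem tate_thetaRelation_zpow_mul_right_iff (hq : ‖q‖ < 1) (hq0 : q ≠ 0) {u₁ v : K}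
    (hu₁ : u₁ ≠ 0) (hv : v ≠ 0) (k : ℤ) :
    (tateX q u₁ - tateX q (q ^ k * v)) * tateTheta q u₁ ^ 2 * tateTheta q (q ^ k * v) ^ 2 =
        -(q ^ k * v * tateTheta q (u₁ * (q ^ k * v)) * tateTheta q (u₁ * (q ^ k * v)⁻¹)) ↔
      (tateX q u₁ - tateX q v) * tateTheta q u₁ ^ 2 * tateTheta q v ^ 2 =
        -(v * tateTheta q (u₁ * v) * tateTheta q (u₁ * v⁻¹)) := by
  induction k using Int.induction_on with
  | zero => rw [zpow_zero, one_mul]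
  | succ k ih =>
    rw [zpow_add_one₀ hq0, mul_comm (q ^ (k : ℤ)) q, mul_assoc q,
      tate_thetaRelation_mul_right_iff hq hq0 hu₁ (mul_ne_zero (zpow_ne_zero _ hq0) hv), ih]
  | pred k ih =>
    rw [← ih, show q ^ (-(k : ℤ)) * v = q * (q ^ (-(k : ℤ) - 1) * v) by
      rw [← mul_assoc, ← zpow_one_add₀ hq0]; ring_nf,
      tate_thetaRelation_mul_right_iff hq hq0 hu₁ (mul_ne_zero (zpow_ne_zero _ hq0) hv)]

/-- **Silverman ATAEC Prop. V.3.2 (b)(i)** in every complete nontrivially normed field `K`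
(in particular `ℚ_p` and its finite extensions, or `ℂ`): for `0 < ‖q‖ < 1` and
`u₁, u₂ ∈ K^* ∖ q^ℤ`,
`(X(u₁,q) − X(u₂,q)) · θ(u₁,q)² · θ(u₂,q)² = −u₂ · θ(u₁u₂,q) · θ(u₁u₂⁻¹,q)`
with `X = tateX`, `θ = tateTheta` (the normalised theta function of (a)). Reduction to the annulus
`‖q‖ < ‖qᵏu‖ ≤ 1` (`exists_zpow_mul_norm_mem_Ioc`) by the invariance lemmas, where it is
`tate_thetaRelation_annulus`. [cite: SilvermanATAEC1994, Prop. V.3.2 (b) (PDF pp. 399–400)] -/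
theorem tate_thetaRelation (hq0 : q ≠ 0) (hq : ‖q‖ < 1) {u₁ u₂ : K} (hu₁ : u₁ ≠ 0)
    (hu₂ : u₂ ≠ 0) (hq₁ : ∀ n : ℤ, u₁ ≠ q ^ n) (hq₂ : ∀ n : ℤ, u₂ ≠ q ^ n) :
    (tateX q u₁ - tateX q u₂) * tateTheta q u₁ ^ 2 * tateTheta q u₂ ^ 2 =
      -(u₂ * tateTheta q (u₁ * u₂) * tateTheta q (u₁ * u₂⁻¹)) := by
  have hb : 1 < ‖q‖⁻¹ := one_lt_inv_iff₀.mpr ⟨norm_pos_iff.mpr hq0, hq⟩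
  obtain ⟨k₁, hk₁, hk₁'⟩ := exists_zpow_mul_norm_mem_Ioc hq0 hq (Units.mk0 u₁ hu₁)
  obtain ⟨k₂, hk₂, hk₂'⟩ := exists_zpow_mul_norm_mem_Ioc hq0 hq (Units.mk0 u₂ hu₂)
  set v₁ : Kˣ := Units.mk0 q hq0 ^ k₁ * Units.mk0 u₁ hu₁ with hv₁
  set v₂ : Kˣ := Units.mk0 q hq0 ^ k₂ * Units.mk0 u₂ hu₂ with hv₂
  have hv₁v : (v₁ : K) = q ^ k₁ * u₁ := by simp [hv₁]
  have hv₂v : (v₂ : K) = q ^ k₂ * u₂ := by simp [hv₂]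
  have n₁ : (v₁ : K) ≠ 1 := by
    intro h; apply hq₁ (-k₁)
    rw [hv₁v] at h; rw [zpow_neg]; exact eq_inv_of_mul_eq_one_right h
  have n₂ : (v₂ : K) ≠ 1 := by
    intro h; apply hq₂ (-k₂)
    rw [hv₂v] at h; rw [zpow_neg]; exact eq_inv_of_mul_eq_one_right h
  have hann := tate_thetaRelation_annulus hq v₁ v₂ hk₁ (hk₁'.trans_lt hb) hk₂ (hk₂'.trans_lt hb) n₁ n₂
  rw [hv₁v, hv₂v] at hann
  rw [tate_thetaRelation_zpow_mul_left_iff hq hq0 hu₁ (mul_ne_zero (zpow_ne_zero _ hq0) hu₂),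
    tate_thetaRelation_zpow_mul_right_iff hq hq0 hu₁ hu₂] at hann
  exact hann

end General

end Literature.NumberTheory.EllipticCurves.TateCurve

end
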